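import Mathlib.LinearAlgebra.Lagrange
import Mathlib.Analysis.Calculus.Taylor
import HarnessLib

/-!
# Extrapolation weights for the dilation–extrapolation extension operator on convex bodies

Support file for the planned proof of `Literature.Analysis.Calculus.WhitneyExtensionConvex`
(`WhitneyExtension.lean`; Whitney (1934), Thm. I, on closed convex sets with nonempty interior)
by a Seeley-type operator adapted to convex bodies: near the boundary of a convex body `K` with
interior point `c`, a function `f` smooth on `K` is approximated outside `K` by the
**extrapolation of its dilates** `u(x) = ∑_{j<q} w_j f(c + μ_j (x - c))`, `μ_j = 1 - 2^j t`,
where the weights `w_j` are the values at `0` of the Lagrange basis polynomials for the nodes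
`2^0, …, 2^{q-1}` — exactly as Seeley's reflection coefficients are the values at `-1`
(`Literature.Analysis.Calculus.Seeley.lag`, `SeeleyExtension.lean`; Seeley (1964), Lemma).  The
weights do not depend on the scale `t`, and they reproduce polynomials of degree `< q`:
`∑_j w_j P(μ_j) = P(1)`.  This file is pure algebra:

* `Literature.Analysis.Calculus.WhitneyConvex.weight q j = ∏_{i<q, i≠j} 2^i / (2^i - 2^j)`,
  `Literature.Analysis.Calculus.WhitneyConvex.eval_zero_basis` (it is the Lagrange basis value
  at `0`);
* `Literature.Analysis.Calculus.WhitneyConvex.sum_weight_mul_pow_pow` — the moment identities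
  `∑_j w_j (2^j)^l = [l = 0]` for `l < q` (Lagrange interpolation of `X^l`, Mathlib's
  `Lagrange.eq_interpolate`), `sum_weight` (`∑_j w_j = 1`);
* `Literature.Analysis.Calculus.WhitneyConvex.dnode t j = 1 - 2^j t` and
  `sum_weight_mul_dnode_sub_pow` — `∑_j w_j (μ_j - μ₀)^l = (1 - μ₀)^l` for `l < q` and any
  centre `μ₀`;
* `Literature.Analysis.Calculus.WhitneyConvex.sum_weight_smul_taylorWithinEval` — consequently
  the weights carry the Taylor polynomial of order `n < q` of any function (Mathlib's
  `taylorWithinEval`, any centre, any set) from the nodes to the point `1`: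
  `∑_j w_j • T_n f(μ_j) = T_n f(1)`.

## References

* R. T. Seeley, *Extension of `C^∞` functions defined in a half space*, Proc. Amer. Math. Soc.
  15 (1964), 625–626 (the Lemma: moment identities for geometric nodes). [Seeley1964]
* H. Whitney, *Analytic extensions of differentiable functions defined in closed sets*, Trans.
  Amer. Math. Soc. 36 (1934), 63–89, Thm. I. [Whitney1934]
-/

open Finset Polynomial
open scoped Nat

noncomputable section

namespace Literature.Analysis.Calculus.WhitneyConvex

/-! ### The weights -/

/-- The geometric nodes `2^j` (as real numbers). [folklore] -/
def gnode (j : ℕ) : ℝ := 2 ^ j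

/-- The geometric nodes are injective in `j`. [folklore] -/
theorem gnode_injective : Function.Injective gnode :=
  (pow_right_strictMono₀ (by norm_num : (1 : ℝ) < 2)).injective

/-- The **extrapolation weights** `w_j = ∏_{i<q, i≠j} 2^i / (2^i - 2^j)`: the values at `0` of
the Lagrange basis polynomials for the nodes `2^0, …, 2^{q-1}` (`eval_zero_basis`).
[cite: Seeley1964, Lemma] -/
def weight (q j : ℕ) : ℝ := ∏ i ∈ (range q).erase j, (2 : ℝ) ^ i / (2 ^ i - 2 ^ j)

/-- The weight `w_j` is the value at `0` of the `j`-th Lagrange basis polynomial for the nodes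
`2^0, …, 2^{q-1}`. [folklore] -/
theorem eval_zero_basis (q j : ℕ) :
    (Lagrange.basis (range q) gnode j).eval 0 = weight q j := by
  rw [Lagrange.basis, eval_prod, weight]
  refine prod_congr rfl fun i hi => ?_
  have hij : i ≠ j := (mem_erase.1 hi).1
  have hne' : (2 : ℝ) ^ i - 2 ^ j ≠ 0 := by
    have := gnode_injective.ne hij
    unfold gnode at this
    exact sub_ne_zero.2 this
  have hne : (2 : ℝ) ^ j - 2 ^ i ≠ 0 := fun h => hne' (by linarith)
  rw [Lagrange.basisDivisor, eval_mul, eval_C, eval_sub, eval_X, eval_C]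
  unfold gnode
  field_simp
  ring

/-- **The moment identities**: `∑_{j<q} w_j (2^j)^l = 0^l` (`= 1` for `l = 0`, `= 0` for
`0 < l < q`) — Lagrange interpolation of `X^l` at the `q` nodes, evaluated at `0`.
[cite: Seeley1964, Lemma] -/
theorem sum_weight_mul_pow_pow {q l : ℕ} (hl : l < q) :
    ∑ j ∈ range q, weight q j * ((2 : ℝ) ^ j) ^ l = (0 : ℝ) ^ l := by
  have hinj : Set.InjOn gnode (range q : Finset ℕ) := gnode_injective.injOn
  have hdeg : ((X : ℝ[X]) ^ l).degree < #(range q) := by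
    rw [degree_X_pow, card_range]; exact_mod_cast hl
  have h := Lagrange.eq_interpolate hinj hdeg
  have h' := congrArg (fun p : ℝ[X] => p.eval 0) h
  simp only [eval_pow, eval_X, Lagrange.interpolate_apply, eval_finsetSum, eval_mul, eval_C,
    eval_zero_basis] at h'
  rw [h']
  refine sum_congr rfl fun j _ => ?_
  rw [gnode, mul_comm]

/-- The weights sum to `1` (the moment identity for `l = 0`). [folklore] -/
theorem sum_weight {q : ℕ} (hq : 0 < q) : ∑ j ∈ range q, weight q j = 1 := by
  have h := sum_weight_mul_pow_pow hq
  simpa using h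

/-- The moment identities for `0 < l < q`: `∑_j w_j (2^j)^l = 0`. [folklore] -/
theorem sum_weight_mul_pow_pow_of_pos {q l : ℕ} (hl : l < q) (hl0 : 0 < l) :
    ∑ j ∈ range q, weight q j * ((2 : ℝ) ^ j) ^ l = 0 := by
  rw [sum_weight_mul_pow_pow hl, zero_pow hl0.ne']

/-! ### The dilation nodes -/

/-- The **dilation nodes** `μ_j = 1 - 2^j t` at scale `t`. [folklore] -/
def dnode (t : ℝ) (j : ℕ) : ℝ := 1 - 2 ^ j * t

/-- Unfolding the dilation nodes. [folklore] -/
theorem dnode_apply (t : ℝ) (j : ℕ) : dnode t j = 1 - 2 ^ j * t := rfl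

/-- `μ_j - 1 = -(2^j t)`. [folklore] -/
theorem dnode_sub_one (t : ℝ) (j : ℕ) : dnode t j - 1 = -(2 ^ j * t) := by
  rw [dnode]; ring

/-- The nodes lie below `1 - t` for `t ≥ 0`. [folklore] -/
theorem dnode_le (j : ℕ) {t : ℝ} (ht : 0 ≤ t) : dnode t j ≤ 1 - t := by
  rw [dnode]
  have h1 : (1 : ℝ) ≤ 2 ^ j := one_le_pow₀ (by norm_num)
  nlinarith

/-- The nodes `μ_j`, `j < q`, lie above `1 - 2^(q-1) t` for `t ≥ 0`. [folklore] -/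
theorem le_dnode {q j : ℕ} (hj : j < q) {t : ℝ} (ht : 0 ≤ t) : 1 - 2 ^ (q - 1) * t ≤ dnode t j := by
  rw [dnode]
  have h1 : (2 : ℝ) ^ j ≤ 2 ^ (q - 1) := pow_le_pow_right₀ (by norm_num) (by omega)
  nlinarith

/-- The nodes are at most `1` for `t ≥ 0`. [folklore] -/
theorem dnode_le_one (j : ℕ) {t : ℝ} (ht : 0 ≤ t) : dnode t j ≤ 1 :=
  (dnode_le j ht).trans (by linarith)

/-- The nodes are positive once `2^(q-1) t < 1`. [folklore] -/
theorem dnode_pos {q j : ℕ} (hj : j < q) {t : ℝ} (ht : 0 ≤ t) (hqt : 2 ^ (q - 1) * t < 1) :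
    0 < dnode t j :=
  lt_of_lt_of_le (by linarith) (le_dnode hj ht)

/-- The nodes decrease in `j` for `t ≥ 0`. [folklore] -/
theorem dnode_anti {t : ℝ} (ht : 0 ≤ t) : Antitone (dnode t) := fun a b hab => by
  rw [dnode, dnode]
  have h1 : (2 : ℝ) ^ a ≤ 2 ^ b := pow_le_pow_right₀ (by norm_num) hab
  nlinarith

/-- The nodes decrease as the scale `t` increases. [folklore] -/
theorem dnode_anti_scale (j : ℕ) : Antitone fun t => dnode t j := fun s t hst => by
  simp only [dnode]
  have h1 : (0 : ℝ) ≤ 2 ^ j := by positivity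
  nlinarith

/-! ### Polynomial reproduction -/

/-- **Polynomial reproduction**: `∑_{j<q} w_j (μ_j - μ₀)^l = (1 - μ₀)^l` for `l < q`, any centre
`μ₀` and any scale `t` — the weights carry monomials centred anywhere from the nodes to the
point `1` (binomial expansion and the moment identities). [folklore] -/
theorem sum_weight_mul_dnode_sub_pow {q l : ℕ} (hl : l < q) (t μ₀ : ℝ) :
    ∑ j ∈ range q, weight q j * (dnode t j - μ₀) ^ l = (1 - μ₀) ^ l := by
  have hsplit : ∀ j, dnode t j - μ₀ = (-t) * 2 ^ j + (1 - μ₀) := fun j => by rw [dnode]; ring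
  calc ∑ j ∈ range q, weight q j * (dnode t j - μ₀) ^ l
      = ∑ j ∈ range q, ∑ i ∈ range (l + 1),
          ((-t) ^ i * (1 - μ₀) ^ (l - i) * (l.choose i : ℝ)) * (weight q j * ((2 : ℝ) ^ j) ^ i) := by
        refine sum_congr rfl fun j _ => ?_
        rw [hsplit, add_pow, mul_sum]
        refine sum_congr rfl fun i _ => ?_
        rw [mul_pow]
        ring
    _ = ∑ i ∈ range (l + 1), ((-t) ^ i * (1 - μ₀) ^ (l - i) * (l.choose i : ℝ)) *
          ∑ j ∈ range q, weight q j * ((2 : ℝ) ^ j) ^ i := by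
        rw [sum_comm]
        simp_rw [mul_sum]
    _ = ∑ i ∈ range (l + 1), ((-t) ^ i * (1 - μ₀) ^ (l - i) * (l.choose i : ℝ)) * (0 : ℝ) ^ i := by
        refine sum_congr rfl fun i hi => ?_
        rw [sum_weight_mul_pow_pow (lt_of_le_of_lt (Nat.lt_succ_iff.1 (mem_range.1 hi)) hl)]
    _ = (1 - μ₀) ^ l := by
        rw [sum_eq_single 0]
        · simp
        · intro i _ hi0
          rw [zero_pow hi0, mul_zero]
        · intro h
          exact absurd (mem_range.2 (Nat.succ_pos l)) h

/-- **The weights reproduce Taylor polynomials**: for `n < q`, any `f : ℝ → F`, any set `s` and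
centre `μ₀`, `∑_{j<q} w_j • T_n f(μ_j) = T_n f(1)` for Mathlib's Taylor polynomial
`taylorWithinEval f n s μ₀` (a polynomial of degree `≤ n` in the evaluation point). This is how
the extrapolation of the dilates recovers a function at the boundary to order `q`. [folklore] -/
theorem sum_weight_smul_taylorWithinEval {F : Type*} [NormedAddCommGroup F] [NormedSpace ℝ F]
    {q n : ℕ} (hn : n < q) (f : ℝ → F) (s : Set ℝ) (μ₀ t : ℝ) :
    ∑ j ∈ range q, weight q j • taylorWithinEval f n s μ₀ (dnode t j) =
      taylorWithinEval f n s μ₀ 1 := by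
  simp_rw [taylor_within_apply, smul_sum, smul_smul]
  rw [sum_comm]
  refine sum_congr rfl fun k hk => ?_
  rw [← sum_smul]
  congr 1
  have hk' : k < q := lt_of_le_of_lt (Nat.lt_succ_iff.1 (mem_range.1 hk)) hn
  calc ∑ j ∈ range q, weight q j * ((k ! : ℝ)⁻¹ * (dnode t j - μ₀) ^ k)
      = (k ! : ℝ)⁻¹ * ∑ j ∈ range q, weight q j * (dnode t j - μ₀) ^ k := by
        rw [mul_sum]
        refine sum_congr rfl fun j _ => ?_
        ring
    _ = (k ! : ℝ)⁻¹ * (1 - μ₀) ^ k := by rw [sum_weight_mul_dnode_sub_pow hk']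

/-! ### The size of the weights -/

/-- The total mass `∑_{j<q} |w_j|` of the weights (the constant in all extrapolation
estimates). [folklore] -/
def weightMass (q : ℕ) : ℝ := ∑ j ∈ range q, |weight q j|

/-- The total mass of the weights is nonnegative. [folklore] -/
theorem weightMass_nonneg (q : ℕ) : 0 ≤ weightMass q := sum_nonneg fun _ _ => abs_nonneg _

/-- Each weight is bounded by the total mass. [folklore] -/
theorem abs_weight_le_weightMass {q j : ℕ} (hj : j < q) : |weight q j| ≤ weightMass q :=
  single_le_sum (f := fun j => |weight q j|) (fun _ _ => abs_nonneg _) (mem_range.2 hj)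

/-- For `q ≥ 1` the total mass is at least `1` (since `∑ w_j = 1`). [folklore] -/
theorem one_le_weightMass {q : ℕ} (hq : 0 < q) : 1 ≤ weightMass q := by
  calc (1 : ℝ) = |∑ j ∈ range q, weight q j| := by rw [sum_weight hq, abs_one]
    _ ≤ weightMass q := abs_sum_le_sum_abs _ _

/-- **Weighted sums are bounded by the mass**: `‖∑_j w_j • v_j‖ ≤ (∑_j |w_j|) · max ‖v_j‖`.
[folklore] -/
theorem norm_sum_weight_smul_le {F : Type*} [SeminormedAddCommGroup F] [NormedSpace ℝ F]
    {q : ℕ} (v : ℕ → F) {C : ℝ} (hC : ∀ j < q, ‖v j‖ ≤ C) :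
    ‖∑ j ∈ range q, weight q j • v j‖ ≤ weightMass q * C := by
  calc ‖∑ j ∈ range q, weight q j • v j‖ ≤ ∑ j ∈ range q, ‖weight q j • v j‖ := norm_sum_le _ _
    _ ≤ ∑ j ∈ range q, |weight q j| * C := by
        refine sum_le_sum fun j hj => ?_
        rw [norm_smul, Real.norm_eq_abs]
        exact mul_le_mul_of_nonneg_left (hC j (mem_range.1 hj)) (abs_nonneg _)
    _ = weightMass q * C := by rw [weightMass, sum_mul]

end Literature.Analysis.Calculus.WhitneyConvex
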